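import Literature.AlgebraicGeometry.HodgeTheory.ComplexGysinIsomorphisms
import Literature.AlgebraicGeometry.HodgeTheory.DiagonalSymmetryStability
import Mathlib.AlgebraicGeometry.Morphisms.IsIso
import HarnessLib

/-!
# Gysin images are equivariant under the diagonal symmetries of a hypersurface: `g_a^*(φ_* y) = (φ ≫ g_{a⁻¹})_* y`

Family `hodge`, layer `Literature/AlgebraicGeometry/HodgeTheory`. PROOF FILE (theorems only; no
definition, no named fact). For a hypersurface `X_F = V₊(F) ⊂ ℙⁿ⁺¹_ℂ` and a diagonal symmetry
`g_a : [z] ↦ [a • z]`, `a ∈ diagonalStabilizer F` (`DiagonalSymmetry`: `diagonalAut`, `diagonalMap`;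
`DiagonalSymmetryStability`: the `g_a` form a group of automorphisms), and for the COMPLEX orientation
family (`ComplexGysinIsomorphisms`: pull-back along an isomorphism is push-forward along its inverse,
Fulton, *Intersection Theory* Lemma 19.1.2 with `deg = 1`):

* `isIso_diagonalProjMap_left`, `isBirational_diagonalProjMap_left` — the projective linear maps
  `[z] ↦ [a • z]` of `ℙⁿ⁺¹` are isomorphisms of schemes, hence birational;
* `isBirational_diagonalAut_left`, `diagonalAut_inv_comp`, `diagonalAut_comp_inv` — the same for the
  `g_a` on `X_F`, with `g_{a⁻¹} ≫ g_a = 𝟙 = g_a ≫ g_{a⁻¹}` over `ℂ`;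
* `map_diagonalAut_complexGysin`, `map_diagonalMap_complexGysin` — **`g_a^*(φ_* y) = (φ ≫ g_{a⁻¹})_* y`**
  for every `φ : E ⟶ X_F` from a smooth projective `E` and `X_F` smooth projective
  ("`g^* cl(Z) = cl(g⁻¹ Z)`", Shioda, Math. Ann. 245 (1979) §1; Ran, Compositio Math. 42 (1980) §1: the
  action of `μₘⁿ⁺²` on the classes of the linear subspaces of the Fermat variety).

## References

* [Shioda1979HodgeFermat] T. Shioda, The Hodge conjecture for Fermat varieties, Math. Ann. 245 (1979), §1.
* [Ran1980] Z. Ran, Cycles on Fermat hypersurfaces, Compositio Math. 42 (1980), §1 (1.1)–(1.3).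
* [Fulton1998] W. Fulton, Intersection Theory, 2nd ed. 1998, §1.4, Lemma 19.1.2.
* [Hartshorne1977] R. Hartshorne, Algebraic Geometry (1977), II Example 7.1.1.
* [StacksProject] The Stacks Project, Tag 01RN.
-/

noncomputable section

open CategoryTheory AlgebraicGeometry MvPolynomial
open Literature.AlgebraicGeometry.Motives Literature.AlgebraicTopology.SingularHomology

namespace Literature.AlgebraicGeometry.HodgeTheory

section HodgeTheory

variable {n : ℕ}

/-! ### The projective linear maps `[z] ↦ [a • z]` and the `g_a` are isomorphisms -/

/-- **`[z] ↦ [a • z]` is an automorphism of the scheme `ℙⁿ⁺¹_ℂ`** with inverse `[z] ↦ [a⁻¹ • z]`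
(`diagonalProjMap_left_mul`, `diagonalProjMap_left_one`). [cite: Hartshorne1977, II Example 7.1.1] -/
theorem isIso_diagonalProjMap_left (a : Fin (n + 2) → ℂˣ) : IsIso (diagonalProjMap (n := n) a).left :=
  ⟨(diagonalProjMap a⁻¹).left, by rw [← diagonalProjMap_left_mul, mul_inv_cancel, diagonalProjMap_left_one],
    by rw [← diagonalProjMap_left_mul, inv_mul_cancel, diagonalProjMap_left_one]⟩

/-- An isomorphism of schemes is birational (local copy of the tree's `isBirational_of_isIso` of
`CycleClassPrincipalDivisorProjectiveSpaceHolds`, kept out of the import cone). [cite: StacksProject, Tag 01RN] -/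
private theorem isBirational_of_isIso_diag {X' X₀ : Scheme} (f : X' ⟶ X₀) [IsIso f] :
    Resolution.IsBirational f := by
  refine ⟨⊤, dense_univ, ?_, ?_⟩
  · rw [Scheme.Hom.preimage_top]
    exact dense_univ
  · exact IsZariskiLocalAtTarget.restrict (P := MorphismProperty.isomorphisms Scheme)
      (show IsIso f from inferInstance) ⊤

/-- `[z] ↦ [a • z]` is birational. [cite: StacksProject, Tag 01RN] -/
theorem isBirational_diagonalProjMap_left (a : Fin (n + 2) → ℂˣ) :
    Resolution.IsBirational (diagonalProjMap (n := n) a).left :=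
  haveI := isIso_diagonalProjMap_left a
  isBirational_of_isIso_diag _

/-- A diagonal symmetry `g_a` of a hypersurface is birational (it is an automorphism,
`isIso_diagonalAut_left`). [cite: StacksProject, Tag 01RN] -/
theorem isBirational_diagonalAut_left (F : MvPolynomial (Fin (n + 2)) ℂ) {a : Fin (n + 2) → ℂˣ}
    (ha : a ∈ diagonalStabilizer F) : Resolution.IsBirational (diagonalAut F ha).left :=
  isBirational_of_isIso_diag _

/-- `g_{a⁻¹} ≫ g_a = 𝟙` over `ℂ`. [folklore] -/
theorem diagonalAut_inv_comp (F : MvPolynomial (Fin (n + 2)) ℂ) {a : Fin (n + 2) → ℂˣ}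
    (ha : a ∈ diagonalStabilizer F) :
    diagonalAut F (inv_mem ha) ≫ diagonalAut F ha = 𝟙 _ :=
  Over.OverMorphism.ext (by rw [Over.comp_left, Over.id_left]; exact diagonalAut_left_inv_comp F ha)

/-- `g_a ≫ g_{a⁻¹} = 𝟙` over `ℂ`. [folklore] -/
theorem diagonalAut_comp_inv (F : MvPolynomial (Fin (n + 2)) ℂ) {a : Fin (n + 2) → ℂˣ}
    (ha : a ∈ diagonalStabilizer F) :
    diagonalAut F ha ≫ diagonalAut F (inv_mem ha) = 𝟙 _ :=
  Over.OverMorphism.ext (by rw [Over.comp_left, Over.id_left]; exact diagonalAut_left_comp_inv F ha)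

/-! ### `g_a^*(φ_* y) = (φ ≫ g_{a⁻¹})_* y` -/

variable {d e : ℕ} {E : Motives.SchemeOver ℂ}

/-- **Gysin images are equivariant under the diagonal symmetries**: for `X_F` smooth projective of
dimension `d`, a diagonal symmetry `g_a` (`a ∈ diagonalStabilizer F`) and `φ : E ⟶ X_F` from a smooth
projective `e`-fold, `g_a^*(φ_* y) = (φ ≫ g_{a⁻¹})_* y` for the complex orientation family
(`complexBetti_map_complexGysin_of_comp_eq_id` for the isomorphism `g_a` with inverse `g_{a⁻¹}`).
[cite: Shioda1979HodgeFermat, §1] [cite: Fulton1998, Lemma 19.1.2 and §1.4] -/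
theorem map_diagonalAut_complexGysin (F : MvPolynomial (Fin (n + 2)) ℂ)
    (hX : IsSmoothProjective d (SmoothHypersurface.hypersurface F)) {a : Fin (n + 2) → ℂˣ}
    (ha : a ∈ diagonalStabilizer F) (hE : IsSmoothProjective e E) (φ : E ⟶ SmoothHypersurface.hypersurface F)
    {c b : ℕ} (hcb : c + 2 * d = b + 2 * e) (y : complexBetti E c) :
    complexBetti.map (diagonalAut F ha) b (complexGysin complexOrientationFamily hE hX φ hcb y) =
      complexGysin complexOrientationFamily hE hX (φ ≫ diagonalAut F (inv_mem ha)) hcb y :=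
  complexBetti_map_complexGysin_of_comp_eq_id hX hX (diagonalAut F ha) (diagonalAut F (inv_mem ha))
    (diagonalAut_inv_comp F ha) (isBirational_diagonalAut_left F (inv_mem ha)) hE φ hcb y

/-- The same through the continuous self-map `diagonalMap F ha = g_a(ℂ)` of `X_F(ℂ)` (the spelling of
the eigenspaces `diagonalCharacterEigenspace` / `fermatEigenspace` and of the projectors `eigenProjector`).
[cite: Shioda1979HodgeFermat, §1] [cite: Ran1980, §1 (1.1)–(1.3)] -/
theorem map_diagonalMap_complexGysin (F : MvPolynomial (Fin (n + 2)) ℂ)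
    (hX : IsSmoothProjective d (SmoothHypersurface.hypersurface F)) {a : Fin (n + 2) → ℂˣ}
    (ha : a ∈ diagonalStabilizer F) (hE : IsSmoothProjective e E) (φ : E ⟶ SmoothHypersurface.hypersurface F)
    {c b : ℕ} (hcb : c + 2 * d = b + 2 * e) (y : complexBetti E c) :
    singularCohomology.map ℂ ℂ (diagonalMap F ha) b (complexGysin complexOrientationFamily hE hX φ hcb y) =
      complexGysin complexOrientationFamily hE hX (φ ≫ diagonalAut F (inv_mem ha)) hcb y :=
  map_diagonalAut_complexGysin F hX ha hE φ hcb y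

end HodgeTheory

end Literature.AlgebraicGeometry.HodgeTheory

end
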